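import Mathlib
import HarnessLib
import Literature.Analysis.ODE.CompactSupportFlow
import Summits.Ventures.LatticeQCDFlow.Exactness.SphereGradientFlowPullback

/-!
# The time-dependent trivializing flow `ẋ_n = −∂̃_n G_t(x)` on the lattice of site spheres: two-time evolution maps `Φ_{t₀→t}` for every jointly `C²` generator family, the Chapman–Kolmogorov law, conserved site norms, the true equation on `Ω̃`, and the pull-back derivative `(d/ds) H(Φ_{s→c}x) = D(H∘Φ_{s→c})(x)·∂̃G_s(x)`

HONEST FRAMING: exact (Metropolis-corrected) sampling algorithms for lattice gauge theory;
figures of merit are autocorrelation/cost numbers at stated couplings and volumes; no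
continuum-physics claim.

Venture `LatticeQCDFlow` (cell pub-lqcd), topic `Exactness`; FANOUT row 7 (`s0-cpn-null`: the
S0-D1 rung — Lüscher's trivializing flow for the lattice CP(N−1)/O(N) action, Engel–Schaefer 2011).
NEW WORK of the cell over the tree's PROVED `Literature/Analysis/ODE/CompactSupportFlow.lean`
(`tdFlow`: the evolution maps of a compactly supported `C¹` time-dependent field — Lang GTM 160
IV §1, Hirsch GTM 33 Ch. 8 §1 — with `tdFlow_self`, `hasDerivAt_tdFlow`, `tdFlow_trans`,
`contDiff_tdFlow`, `tdFlow_eq_of_hasDerivAt`), `Exactness/SphereGradientFlow.lean` (GEN-13: the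
radial cut-off `sphereCutoff`, Euler's relation `⟪∂̃_nG(x), x_n⟫ = 0`) and
`Exactness/SphereLatticeGreen.lean` (`contDiff_update_prod`, `contDiffAt_normalize`); nothing is
cited as a fact.  Printed counterpart, NAMED ONLY: M. Lüscher, Commun. Math. Phys. 293 (2010) 899,
§3.1–3.2 (the flow `U̇_t = Z_t(U_t)` with a `t`-DEPENDENT generator `Z_t = −∂S̃_t` and its
integrability for all `t` on a compact field manifold); Engel–Schaefer 2011 §3 eq. (14).

GEN-13's `SphereGradientFlow.lean` treated AUTONOMOUS generators only (each fixed truncation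
`S̃⁽⁰⁾`, … used as a time-independent generator, as the rung's LO map does); its NOT-CLAIMED list had
"time-dependent generators `S̃_t` (Lüscher's actual flow uses `∂̃S̃_t` with `t`-dependent `S̃_t`)".
THIS FILE constructs the time-dependent flow for every family `G : ℝ → (Λ → E) → ℝ` that is
jointly `C²` in `(t, x)`, with a time horizon parameter `T`:

* §1 **THE DOUBLY CUT-OFF FIELD** `X_T(t, x)_n = −ψ_T(t)·χ(x)·∂̃_nG_t(x)` (`ψ_T` a smooth bump in
  time, `= 1` for `|t| ≤ |T| + 1`, `= 0` for `|t| ≥ |T| + 2`; `χ` GEN-13's radial cut-off): jointly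
  `C¹` on `ℝ × (Λ → E)` (**`contDiff_sphereTDField`**, through the PARAMETRIC smoothness of the
  natural gradient **`contDiffAt_siteGrad_param`**), compactly supported in space-time, radially
  tangent;
* §2 **THE EVOLUTION MAPS** `sphereTDFlow hG T t₀ t : (Λ → E) → (Λ → E)` (Literature `tdFlow`):
  `Φ_{t₀→t₀} = id`, the Chapman–Kolmogorov law `Φ_{t₁→t₂}∘Φ_{t₀→t₁} = Φ_{t₀→t₂}`, joint `C¹`
  smoothness in `(t₀, t, x)`, **every site norm is conserved** (**`norm_sphereTDFlow_apply`**), and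
  ON `Ω̃` FOR `|t| ≤ |T| + 1` THE FLOW SOLVES THE TRUE EQUATION `ẋ_n = −∂̃_nG_t(x)`
  (**`hasDerivAt_sphereTDFlow`**);
* §3 **THE INITIAL-TIME DERIVATIVE** `(d/ds) Φ_{s→t}(x)|_{t=s} = −X_T(s, x)`
  (**`hasDerivAt_sphereTDFlow_initial`**: differentiate `Φ_{s→s}(x) = x` along the diagonal) and
  **THE PULL-BACK DERIVATIVE** (**`hasDerivAt_comp_sphereTDFlow_initial`**): for `H` differentiable
  and `x ∈ Ω̃`, `(d/ds) H(Φ_{s→c}(x)) = D(H∘Φ_{s→c})(x)·(ψ_T(s)∂̃G_s(x))` at every real `s` — the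
  hypothesis of the transport identity of `Exactness/SphereFlowTransport.lean` for the family
  `Ψ_s = Φ_{s→c}` with the effective generator `ψ_T(s)·G_s` (`= G_s` for `|s| ≤ |T| + 1`).

NOT CLAIMED: the Jacobian of `Φ_{t₀→t}`; independence of the flow from the cut-offs beyond the
stated window (inside the window it follows from uniqueness, **`sphereTDFlow_eq_of_hasDerivAt`**);
anything quantitative.
-/

noncomputable section

namespace Summit.Ventures.LatticeQCDFlow.Exactness

open Function Set Metric MeasureTheory NormedSpace InnerProductSpace Literature.Analysis.ODE
open scoped RealInnerProductSpace NNReal Topology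

variable {Λ : Type*} {E : Type*} [NormedAddCommGroup E] [InnerProductSpace ℝ E] [Fintype Λ]

/-! ## §1 The doubly cut-off field -/

section Field

/-- **The time bump** `ψ_T`: a smooth bump on `ℝ` centred at `0` with `rIn = |T| + 1`,
`rOut = |T| + 2`. -/
def timeBump (T : ℝ) : ContDiffBump (0 : ℝ) :=
  ⟨|T| + 1, |T| + 2, by positivity, by linarith [abs_nonneg T]⟩

/-- `ψ_T(t) = 1` for `|t| ≤ |T| + 1`. -/
theorem timeBump_eq_one {T t : ℝ} (ht : |t| ≤ |T| + 1) : (timeBump T : ℝ → ℝ) t = 1 :=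
  (timeBump T).one_of_mem_closedBall (by
    rw [mem_closedBall, dist_zero_right, Real.norm_eq_abs]; exact ht)

/-- `ψ_T(t) = 1` on `[0, T]` for `0 ≤ T`. -/
theorem timeBump_eq_one_of_mem_Icc {T t : ℝ} (hT : 0 ≤ T) (ht : t ∈ Icc 0 T) :
    (timeBump T : ℝ → ℝ) t = 1 :=
  timeBump_eq_one (by rw [abs_of_nonneg ht.1, abs_of_nonneg hT]; linarith [ht.2])

/-- `ψ_T(t) = 0` for `|T| + 2 ≤ |t|`. -/
theorem timeBump_eq_zero {T t : ℝ} (ht : |T| + 2 ≤ |t|) : (timeBump T : ℝ → ℝ) t = 0 :=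
  (timeBump T).zero_of_le_dist (by rw [dist_zero_right, Real.norm_eq_abs]; exact ht)

variable [FiniteDimensional ℝ E] [DecidableEq Λ]

/-- **Parametric smoothness of E–S's natural gradient**: for a family `G_t(x)` jointly `C²` in
`(t, x)`, `(t, x) ↦ ∂̃_nG_t(x)` is jointly `C¹` at every `(t, x)` with `x_n ≠ 0`. -/
theorem contDiffAt_siteGrad_param {G : ℝ → (Λ → E) → ℝ}
    (hG : ContDiff ℝ 2 fun q : ℝ × (Λ → E) => G q.1 q.2) (n : Λ) {q : ℝ × (Λ → E)}
    (hq : q.2 n ≠ 0) :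
    ContDiffAt ℝ 1 (fun q' : ℝ × (Λ → E) => siteGrad n (G q'.1) q'.2) q := by
  have hA : ContDiffAt ℝ 2 (fun r : (ℝ × (Λ → E)) × E => normalize r.2) (q, q.2 n) :=
    ContDiffAt.comp (q, q.2 n) (contDiffAt_normalize hq) contDiffAt_snd
  have hB : ContDiffAt ℝ 2 (fun r : (ℝ × (Λ → E)) × E => (r.1.2, normalize r.2)) (q, q.2 n) :=
    (ContDiffAt.comp (q, q.2 n) contDiffAt_snd contDiffAt_fst).prodMk hA
  have hC : ContDiffAt ℝ 2 (fun r : (ℝ × (Λ → E)) × E => update r.1.2 n (normalize r.2))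
      (q, q.2 n) :=
    ContDiffAt.comp (q, q.2 n) (contDiff_update_prod n).contDiffAt hB
  have hD : ContDiffAt ℝ 2 (fun r : (ℝ × (Λ → E)) × E =>
      ((r.1.1, update r.1.2 n (normalize r.2)) : ℝ × (Λ → E))) (q, q.2 n) :=
    (ContDiffAt.comp (q, q.2 n) contDiffAt_fst contDiffAt_fst).prodMk hC
  have hf : ContDiffAt ℝ 2 (uncurry fun (q' : ℝ × (Λ → E)) (y : E) =>
      G q'.1 (update q'.2 n (normalize y))) (q, q.2 n) :=
    ContDiffAt.comp (q, q.2 n) hG.contDiffAt hD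
  have hg : ContDiffAt ℝ 1 (fun q' : ℝ × (Λ → E) => q'.2 n) q :=
    ((contDiff_apply ℝ E n).comp contDiff_snd).contDiffAt
  have h2 := hf.fderiv hg (by norm_num : (1 : WithTop ℕ∞) + 1 ≤ 2)
  exact (toDual ℝ E).symm.contDiff.contDiffAt.comp q h2

/-- **The doubly cut-off field** `X_T(t, x)_n = −ψ_T(t)·χ(x)·∂̃_nG_t(x)`. -/
def sphereTDField (G : ℝ → (Λ → E) → ℝ) (T : ℝ) (q : ℝ × (Λ → E)) : Λ → E :=
  fun n => -(((timeBump T : ℝ → ℝ) q.1 * sphereCutoff q.2) • siteGrad n (G q.1) q.2)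

variable {G : ℝ → (Λ → E) → ℝ} {T : ℝ}

/-- On `Ω̃` the field is `−ψ_T(t)·∂̃G_t`. -/
theorem sphereTDField_eq_of_norm_eq_one (t : ℝ) {x : Λ → E} (hx : ∀ n, ‖x n‖ = 1) :
    sphereTDField G T (t, x) = fun n => -((timeBump T : ℝ → ℝ) t • siteGrad n (G t) x) := by
  funext n
  simp only [sphereTDField, sphereCutoff_eq_one hx, mul_one]

/-- On `Ω̃` and inside the time window `|t| ≤ |T| + 1` the field is the true generator `−∂̃G_t`. -/
theorem sphereTDField_eq_of_norm_eq_one_of_abs_le {t : ℝ} (ht : |t| ≤ |T| + 1) {x : Λ → E}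
    (hx : ∀ n, ‖x n‖ = 1) : sphereTDField G T (t, x) = fun n => -siteGrad n (G t) x := by
  rw [sphereTDField_eq_of_norm_eq_one t hx]
  funext n
  rw [timeBump_eq_one ht, one_smul]

/-- **The field is radially tangent**: `⟪X_T(t, x)_n, x_n⟫ = 0` (each `G_t` differentiable). -/
theorem inner_sphereTDField_self_eq_zero (hGd : ∀ t, Differentiable ℝ (G t)) (q : ℝ × (Λ → E))
    (n : Λ) : ⟪sphereTDField G T q n, q.2 n⟫ = 0 := by
  by_cases hx : q.2 n = 0
  · rw [hx, inner_zero_right]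
  · rw [sphereTDField, inner_neg_left, real_inner_smul_left, inner_siteGrad_self_eq_zero (hGd q.1) n hx,
      mul_zero, neg_zero]

omit [FiniteDimensional ℝ E] [DecidableEq Λ] in
/-- Each `G_t` is `C²` when the family is jointly `C²`. -/
theorem contDiff_of_joint (hG : ContDiff ℝ 2 fun q : ℝ × (Λ → E) => G q.1 q.2) (t : ℝ) :
    ContDiff ℝ 2 (G t) :=
  hG.comp (contDiff_const.prodMk contDiff_id)

/-- **The doubly cut-off field is jointly `C¹` on `ℝ × (Λ → E)`** (for a jointly `C²` family):
off the poles a product of smooth and `C¹` maps, near a pole identically zero. -/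
theorem contDiff_sphereTDField (hG : ContDiff ℝ 2 fun q : ℝ × (Λ → E) => G q.1 q.2) (T : ℝ) :
    ContDiff ℝ 1 (sphereTDField G T) := by
  refine contDiff_pi.2 fun n => contDiff_iff_contDiffAt.2 fun q₀ => ?_
  have hψ : ContDiff ℝ 1 (timeBump T : ℝ → ℝ) :=
    contDiff_infty.1 (ContDiffBump.contDiff (n := ⊤) (timeBump T)) 1
  have hscal : ContDiff ℝ 1 fun q : ℝ × (Λ → E) => (timeBump T : ℝ → ℝ) q.1 * sphereCutoff q.2 :=
    (hψ.comp contDiff_fst).mul ((contDiff_sphereCutoff 1).comp contDiff_snd)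
  by_cases h : ∀ m, q₀.2 m ≠ 0
  · exact (hscal.contDiffAt.smul (contDiffAt_siteGrad_param hG n (h n))).neg
  · simp only [ne_eq, not_forall, not_not] at h
    obtain ⟨m, hm⟩ := h
    have hm' : ‖q₀.2 m‖ ^ 2 < 1 / 4 := by rw [hm, norm_zero]; norm_num
    have hopen : IsOpen {q : ℝ × (Λ → E) | ‖q.2 m‖ ^ 2 < 1 / 4} :=
      isOpen_lt (((continuous_apply m).comp continuous_snd).norm.pow 2) continuous_const
    have hev : (fun q : ℝ × (Λ → E) => sphereTDField G T q n) =ᶠ[𝓝 q₀] fun _ => 0 := by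
      filter_upwards [hopen.mem_nhds hm'] with q hq
      simp only [sphereTDField, sphereCutoff_eq_zero_of_le (le_of_lt hq), mul_zero, zero_smul,
        neg_zero]
    exact (contDiffAt_const (c := (0 : E))).congr_of_eventuallyEq hev

/-- The field vanishes off the closed ball of radius `|T| + 2` in space-time (sup norm). -/
theorem sphereTDField_eq_zero_of_norm {q : ℝ × (Λ → E)} (hq : |T| + 2 < ‖q‖) :
    sphereTDField G T q = 0 := by
  funext n
  rw [Prod.norm_def] at hq
  rcases lt_max_iff.1 hq with h1 | h2
  · rw [Real.norm_eq_abs] at h1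
    simp only [sphereTDField, timeBump_eq_zero h1.le, zero_mul, zero_smul, neg_zero, Pi.zero_apply]
  · have h2' : 2 < ‖q.2‖ := by linarith [abs_nonneg T]
    simp only [sphereTDField, sphereCutoff_eq_zero_of_norm h2', mul_zero, zero_smul, neg_zero,
      Pi.zero_apply]

/-- **The doubly cut-off field has compact support in space-time.** -/
theorem hasCompactSupport_sphereTDField (T : ℝ) : HasCompactSupport (sphereTDField G T) :=
  HasCompactSupport.intro (isCompact_closedBall (0 : ℝ × (Λ → E)) (|T| + 2)) fun q hq =>
    sphereTDField_eq_zero_of_norm (by simpa [mem_closedBall, dist_zero_right] using hq)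

end Field

/-! ## §2 The evolution maps -/

section Flow

variable [FiniteDimensional ℝ E] [DecidableEq Λ] {G : ℝ → (Λ → E) → ℝ} {T : ℝ}

/-- **The time-dependent trivializing flow on the lattice of site spheres**: `sphereTDFlow hG T t₀ t x`
is the position at time `t` of the solution of `ẋ = X_T(t, x)` through `x` at time `t₀`
(Literature `tdFlow`); on `Ω̃` and for times in `[−|T|−1, |T|+1]` this is Lüscher's flow
`ẋ_n = −∂̃_nG_t(x)`. -/
def sphereTDFlow (hG : ContDiff ℝ 2 fun q : ℝ × (Λ → E) => G q.1 q.2) (T : ℝ) :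
    ℝ → ℝ → (Λ → E) → (Λ → E) :=
  tdFlow (contDiff_sphereTDField hG T) (hasCompactSupport_sphereTDField T) le_rfl

/-- `Φ_{t₀→t₀} = id`. -/
@[simp]
theorem sphereTDFlow_self (hG : ContDiff ℝ 2 fun q : ℝ × (Λ → E) => G q.1 q.2) (t₀ : ℝ)
    (x : Λ → E) : sphereTDFlow hG T t₀ t₀ x = x :=
  tdFlow_self _ _ _ t₀ x

/-- The flow lines solve the cut-off equation `ẋ = X_T(t, x)` everywhere. -/
theorem hasDerivAt_sphereTDFlow_field (hG : ContDiff ℝ 2 fun q : ℝ × (Λ → E) => G q.1 q.2)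
    (t₀ : ℝ) (x : Λ → E) (t : ℝ) :
    HasDerivAt (fun s => sphereTDFlow hG T t₀ s x)
      (sphereTDField G T (t, sphereTDFlow hG T t₀ t x)) t :=
  hasDerivAt_tdFlow _ _ _ t₀ x t

/-- **Chapman–Kolmogorov**: `Φ_{t₁→t₂}(Φ_{t₀→t₁}(x)) = Φ_{t₀→t₂}(x)`. -/
theorem sphereTDFlow_trans (hG : ContDiff ℝ 2 fun q : ℝ × (Λ → E) => G q.1 q.2) (t₀ t₁ t₂ : ℝ)
    (x : Λ → E) :
    sphereTDFlow hG T t₁ t₂ (sphereTDFlow hG T t₀ t₁ x) = sphereTDFlow hG T t₀ t₂ x :=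
  tdFlow_trans _ _ _ t₀ t₁ t₂ x

/-- Evolving from `t₀` to `t₁` and back is the identity. -/
@[simp]
theorem sphereTDFlow_symm (hG : ContDiff ℝ 2 fun q : ℝ × (Λ → E) => G q.1 q.2) (t₀ t₁ : ℝ)
    (x : Λ → E) : sphereTDFlow hG T t₁ t₀ (sphereTDFlow hG T t₀ t₁ x) = x :=
  tdFlow_tdFlow_symm _ _ _ t₀ t₁ x

/-- **Joint smoothness** in `(t₀, t, x)`. -/
theorem contDiff_sphereTDFlow (hG : ContDiff ℝ 2 fun q : ℝ × (Λ → E) => G q.1 q.2) :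
    ContDiff ℝ 1 fun p : ℝ × ℝ × (Λ → E) => sphereTDFlow hG T p.1 p.2.1 p.2.2 :=
  contDiff_tdFlow _ _ _

/-- Each evolution map `x ↦ Φ_{t₀→t}(x)` is `C¹`. -/
theorem contDiff_sphereTDFlow_apply (hG : ContDiff ℝ 2 fun q : ℝ × (Λ → E) => G q.1 q.2)
    (t₀ t : ℝ) : ContDiff ℝ 1 (sphereTDFlow hG T t₀ t) :=
  contDiff_tdFlow_apply _ _ _ t₀ t

/-- `(s, x) ↦ Φ_{s→c}(x)` is jointly `C¹` (the pull-back family of the transport identity). -/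
theorem contDiff_sphereTDFlow_initial (hG : ContDiff ℝ 2 fun q : ℝ × (Λ → E) => G q.1 q.2)
    (c : ℝ) : ContDiff ℝ 1 fun q : ℝ × (Λ → E) => sphereTDFlow hG T q.1 c q.2 :=
  (contDiff_sphereTDFlow hG).comp (contDiff_fst.prodMk (contDiff_const.prodMk contDiff_snd))

/-- **EVERY SITE NORM IS CONSERVED**: `‖Φ_{t₀→t}(x)_n‖ = ‖x_n‖` (the field is radially tangent). -/
theorem norm_sphereTDFlow_apply (hG : ContDiff ℝ 2 fun q : ℝ × (Λ → E) => G q.1 q.2) (t₀ : ℝ)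
    (x : Λ → E) (t : ℝ) (n : Λ) : ‖sphereTDFlow hG T t₀ t x n‖ = ‖x n‖ := by
  have hGd : ∀ s, Differentiable ℝ (G s) := fun s => (contDiff_of_joint hG s).differentiable (by norm_num)
  set γ : ℝ → E := fun s => sphereTDFlow hG T t₀ s x n with hγ
  have hγ' : ∀ s, HasDerivAt γ (sphereTDField G T (s, sphereTDFlow hG T t₀ s x) n) s := fun s =>
    (hasDerivAt_pi.1 (hasDerivAt_sphereTDFlow_field hG t₀ x s)) n
  have hsq : ∀ s, HasDerivAt (fun s => ⟪γ s, γ s⟫) 0 s := fun s => by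
    have h := (hγ' s).inner ℝ (hγ' s)
    have h0 := inner_sphereTDField_self_eq_zero (T := T) hGd (s, sphereTDFlow hG T t₀ s x) n
    simp only at h0
    rw [h0, real_inner_comm, h0, add_zero] at h
    exact h
  have hconst := is_const_of_deriv_eq_zero (f := fun s => ⟪γ s, γ s⟫)
    (fun s => (hsq s).differentiableAt) (fun s => (hsq s).deriv) t t₀
  simp only [hγ, sphereTDFlow_self, real_inner_self_eq_norm_sq] at hconst
  exact (sq_eq_sq₀ (norm_nonneg _) (norm_nonneg _)).1 hconst

/-- **The product of unit spheres is invariant.** -/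
theorem norm_sphereTDFlow_eq_one (hG : ContDiff ℝ 2 fun q : ℝ × (Λ → E) => G q.1 q.2) (t₀ : ℝ)
    {x : Λ → E} (hx : ∀ n, ‖x n‖ = 1) (t : ℝ) (n : Λ) : ‖sphereTDFlow hG T t₀ t x n‖ = 1 := by
  rw [norm_sphereTDFlow_apply hG t₀ x t n, hx n]

/-- On `Ω̃` the flow solves `ẋ_n = −ψ_T(t)·∂̃_nG_t(x)` at every time. -/
theorem hasDerivAt_sphereTDFlow_bump (hG : ContDiff ℝ 2 fun q : ℝ × (Λ → E) => G q.1 q.2)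
    (t₀ : ℝ) {x : Λ → E} (hx : ∀ n, ‖x n‖ = 1) (t : ℝ) :
    HasDerivAt (fun s => sphereTDFlow hG T t₀ s x)
      (fun n => -((timeBump T : ℝ → ℝ) t • siteGrad n (G t) (sphereTDFlow hG T t₀ t x))) t := by
  have h := hasDerivAt_sphereTDFlow_field hG t₀ x t (T := T)
  rwa [sphereTDField_eq_of_norm_eq_one t (norm_sphereTDFlow_eq_one hG t₀ hx t)] at h

/-- **ON `Ω̃` AND INSIDE THE TIME WINDOW THE FLOW SOLVES LÜSCHER'S EQUATION** `ẋ_n = −∂̃_nG_t(x)`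
(`|t| ≤ |T| + 1`). -/
theorem hasDerivAt_sphereTDFlow (hG : ContDiff ℝ 2 fun q : ℝ × (Λ → E) => G q.1 q.2) (t₀ : ℝ)
    {x : Λ → E} (hx : ∀ n, ‖x n‖ = 1) {t : ℝ} (ht : |t| ≤ |T| + 1) :
    HasDerivAt (fun s => sphereTDFlow hG T t₀ s x)
      (fun n => -siteGrad n (G t) (sphereTDFlow hG T t₀ t x)) t := by
  have h := hasDerivAt_sphereTDFlow_field hG t₀ x t (T := T)
  rwa [sphereTDField_eq_of_norm_eq_one_of_abs_le ht (norm_sphereTDFlow_eq_one hG t₀ hx t)] at h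

/-- **UNIQUENESS inside the window**: a curve on `Ω̃` solving `ẋ_n = −∂̃_nG_t(x)` on an open
interval `(a, b) ⊆ [−|T|−1, |T|+1]` containing `t₀` is transported by the evolution maps. -/
theorem sphereTDFlow_eq_of_hasDerivAt (hG : ContDiff ℝ 2 fun q : ℝ × (Λ → E) => G q.1 q.2)
    {γ : ℝ → (Λ → E)} {a b t₀ : ℝ} (ht₀ : t₀ ∈ Ioo a b) (hab : Ioo a b ⊆ Icc (-(|T| + 1)) (|T| + 1))
    (hsph : ∀ t ∈ Ioo a b, ∀ n, ‖γ t n‖ = 1)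
    (hγ : ∀ t ∈ Ioo a b, HasDerivAt γ (fun n => -siteGrad n (G t) (γ t)) t) {t : ℝ}
    (ht : t ∈ Ioo a b) : sphereTDFlow hG T t₀ t (γ t₀) = γ t := by
  refine tdFlow_eq_of_hasDerivAt _ _ _ ht₀ (fun s hs => ?_) ht
  have hs' : |s| ≤ |T| + 1 := abs_le.2 ⟨(hab hs).1, (hab hs).2⟩
  rw [sphereTDField_eq_of_norm_eq_one_of_abs_le hs' (hsph s hs)]
  exact hγ s hs

end Flow

/-! ## §3 The initial-time derivative and the pull-back derivative -/

section Pullback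

variable [FiniteDimensional ℝ E] [DecidableEq Λ] {G : ℝ → (Λ → E) → ℝ} {T : ℝ}

/-- **THE INITIAL-TIME DERIVATIVE**: `s' ↦ Φ_{s'→s}(x)` passes through `x` at `s' = s` with
velocity `−X_T(s, x)` (differentiate `Φ_{s'→s'}(x) = x` along the diagonal and subtract the
final-time derivative `X_T(s, x)`). -/
theorem hasDerivAt_sphereTDFlow_initial (hG : ContDiff ℝ 2 fun q : ℝ × (Λ → E) => G q.1 q.2)
    (s : ℝ) (x : Λ → E) :
    HasDerivAt (fun s' => sphereTDFlow hG T s' s x) (-sphereTDField G T (s, x)) s := by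
  -- `Ψ(a, b) = Φ_{a→b}(x)` is `C¹`
  set Ψ : ℝ × ℝ → (Λ → E) := fun p => sphereTDFlow hG T p.1 p.2 x with hΨ
  have hΨd : ContDiff ℝ 1 Ψ :=
    (contDiff_sphereTDFlow hG).comp (contDiff_fst.prodMk (contDiff_snd.prodMk contDiff_const))
  have hL := (hΨd.differentiable one_ne_zero (s, s)).hasFDerivAt
  set L := fderiv ℝ Ψ (s, s) with hLdef
  -- derivative in the final time: `L (0, 1) = X(s, x)`
  have h2a : HasDerivAt (Ψ ∘ fun b : ℝ => (s, b)) (L ((0 : ℝ), (1 : ℝ))) s :=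
    hL.comp_hasDerivAt_of_eq s ((hasDerivAt_const s s).prodMk (hasDerivAt_id' s)) rfl
  have h2b : HasDerivAt (Ψ ∘ fun b : ℝ => (s, b)) (sphereTDField G T (s, x)) s := by
    have h := hasDerivAt_sphereTDFlow_field hG s x s (T := T)
    simp only [sphereTDFlow_self] at h
    exact h
  have h2 : L ((0 : ℝ), (1 : ℝ)) = sphereTDField G T (s, x) := h2a.unique h2b
  -- derivative along the diagonal: `L (1, 1) = 0`
  have h3a : HasDerivAt (Ψ ∘ fun a : ℝ => (a, a)) (L ((1 : ℝ), (1 : ℝ))) s :=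
    hL.comp_hasDerivAt_of_eq s ((hasDerivAt_id' s).prodMk (hasDerivAt_id' s)) rfl
  have h3b : HasDerivAt (Ψ ∘ fun a : ℝ => (a, a)) (0 : Λ → E) s := by
    have e : (Ψ ∘ fun a : ℝ => (a, a)) = fun _ => x := by
      funext a; simp [hΨ]
    rw [e]
    exact hasDerivAt_const s x
  have h3 : L ((1 : ℝ), (1 : ℝ)) = 0 := h3a.unique h3b
  -- derivative in the initial time: `L (1, 0) = L (1, 1) − L (0, 1)`
  have h1 : HasDerivAt (Ψ ∘ fun a : ℝ => (a, s)) (L ((1 : ℝ), (0 : ℝ))) s :=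
    hL.comp_hasDerivAt_of_eq s ((hasDerivAt_id' s).prodMk (hasDerivAt_const s s)) rfl
  have hsplit : L ((1 : ℝ), (0 : ℝ)) = L ((1 : ℝ), (1 : ℝ)) - L ((0 : ℝ), (1 : ℝ)) := by
    rw [← map_sub]
    congr 1
    simp
  rw [hsplit, h3, h2, zero_sub] at h1
  exact h1

/-- On `Ω̃`: `(d/ds') Φ_{s'→s}(x)|_{s'=s} = +ψ_T(s)·∂̃G_s(x)`. -/
theorem hasDerivAt_sphereTDFlow_initial_of_norm_eq_one
    (hG : ContDiff ℝ 2 fun q : ℝ × (Λ → E) => G q.1 q.2) (s : ℝ) {x : Λ → E} (hx : ∀ n, ‖x n‖ = 1) :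
    HasDerivAt (fun s' => sphereTDFlow hG T s' s x)
      (fun n => (timeBump T : ℝ → ℝ) s • siteGrad n (G s) x) s := by
  have h := hasDerivAt_sphereTDFlow_initial hG s x (T := T)
  rw [sphereTDField_eq_of_norm_eq_one s hx] at h
  have e : (-fun n => -((timeBump T : ℝ → ℝ) s • siteGrad n (G s) x)) =
      fun n => (timeBump T : ℝ → ℝ) s • siteGrad n (G s) x := by
    funext n; simp
  rwa [e] at h

/-- **THE PULL-BACK DERIVATIVE FOR THE TIME-DEPENDENT FLOW.**  For `H` differentiable, `x ∈ Ω̃` and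
all real `c`, `s`: `s' ↦ H(Φ_{s'→c}(x))` has derivative `D(H∘Φ_{s→c})(x)·(ψ_T(s)∂̃G_s(x))` at `s`
(Chapman–Kolmogorov `Φ_{s'→c} = Φ_{s→c}∘Φ_{s'→s}` and the chain rule). -/
theorem hasDerivAt_comp_sphereTDFlow_initial (hG : ContDiff ℝ 2 fun q : ℝ × (Λ → E) => G q.1 q.2)
    {H : (Λ → E) → ℝ} (hH : Differentiable ℝ H) {x : Λ → E} (hx : ∀ n, ‖x n‖ = 1) (c s : ℝ) :
    HasDerivAt (fun s' => H (sphereTDFlow hG T s' c x))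
      (fderiv ℝ (fun z => H (sphereTDFlow hG T s c z)) x
        (fun n => (timeBump T : ℝ → ℝ) s • siteGrad n (G s) x)) s := by
  have hK : DifferentiableAt ℝ (fun z => H (sphereTDFlow hG T s c z)) x :=
    (hH.comp ((contDiff_sphereTDFlow_apply hG s c).differentiable one_ne_zero)) x
  have hγ := hasDerivAt_sphereTDFlow_initial_of_norm_eq_one hG s hx (T := T)
  have hx0 : sphereTDFlow hG T s s x = x := sphereTDFlow_self hG s x
  have hK' : HasFDerivAt (fun z => H (sphereTDFlow hG T s c z))
      (fderiv ℝ (fun z => H (sphereTDFlow hG T s c z)) x) (sphereTDFlow hG T s s x) := by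
    rw [hx0]; exact hK.hasFDerivAt
  have h := hK'.comp_hasDerivAt s hγ
  refine h.congr_of_eventuallyEq (Filter.Eventually.of_forall fun s' => ?_)
  show H (sphereTDFlow hG T s' c x) = H (sphereTDFlow hG T s c (sphereTDFlow hG T s' s x))
  rw [sphereTDFlow_trans]

/-- The same with the effective generator `ψ_T(s)·G_s` written inside the natural gradient:
`∂̃_n(ψ_T(s)·G_s) = ψ_T(s)·∂̃_nG_s` on `Ω̃`. -/
theorem hasDerivAt_comp_sphereTDFlow_initial' (hG : ContDiff ℝ 2 fun q : ℝ × (Λ → E) => G q.1 q.2)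
    {H : (Λ → E) → ℝ} (hH : Differentiable ℝ H) {x : Λ → E} (hx : ∀ n, ‖x n‖ = 1) (c s : ℝ) :
    HasDerivAt (fun s' => H (sphereTDFlow hG T s' c x))
      (fderiv ℝ (fun z => H (sphereTDFlow hG T s c z)) x
        (fun n => siteGrad n (fun z => (timeBump T : ℝ → ℝ) s * G s z) x)) s := by
  have h := hasDerivAt_comp_sphereTDFlow_initial hG hH hx c s (T := T)
  have e : (fun n => siteGrad n (fun z => (timeBump T : ℝ → ℝ) s * G s z) x) =
      fun n => (timeBump T : ℝ → ℝ) s • siteGrad n (G s) x := by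
    funext n
    have hne : x n ≠ 0 := by
      intro h0; have := hx n; rw [h0, norm_zero] at this; exact zero_ne_one this
    exact siteGrad_const_mul hne ((contDiff_of_joint hG s).comp (contDiff_update 2 x n) |>.of_le
      (by norm_num)) _
  rwa [e]

end Pullback

end Summit.Ventures.LatticeQCDFlow.Exactness

end
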